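import Summits.Langlands.Langlands.Theorems.PhantomRMYoshidaResiduallyYoshidaLiftingNonsplitCommutant
import Summits.Langlands.Langlands.Theorems.PhantomRMYoshidaResiduallyYoshidaLiftingResidualSplitting
import Summits.Langlands.Langlands.Theorems.PhantomRMYoshidaResiduallyYoshidaLiftingRibetRealisation
import Mathlib.LinearAlgebra.Matrix.Trace
import HarnessLib

/-!
# No decomposable realiser of a non-trivial residual class — B. The theorem (census F3(i) for crux `ResiduallyYoshidaLifting`)

Lead prover-line-stmt-Langlands-13639-c3-0 (line `sector-klingen-split`, crux `ResiduallyYoshidaLifting`,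
stmt-Langlands-13639), skeleton rev 4.  Companion to Ribet's existence theorem `stub_ribetNonsplitLattice` (R1a) and
the uniqueness theorems `realisedClass_unique` / `class_unique_of_intertwiner` of lead c2-0: the GALOIS-SIDE content of
"`Spec R(ρ̄_B)` has no Yoshida (endoscopic) components" (crux strategist census §3 F3(i)).

**Theorem (`not_blockDiagonal_of_realises_nonsplit`).**  Let `σ, σ' : Γ → GL₂(k)` be irreducible and non-conjugate
over an algebraically closed field `k` of characteristic `p ≠ 2`, `red : ℤ̄_p → k` a ring map, and let
`r : Γ → GL₄(ℚ̄_p)` admit a `ℤ̄_p`-integral frame `rint = P⁻¹ r P` whose reduction through `red` is `GL₄(k)`-conjugate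
to the block upper-triangular `(σ, B; 0, σ')` with `B` NOT a coboundary `σ X - X σ'`.  Then NO `GL₄(ℚ̄_p)`-conjugate of
`r` is block-diagonal `τ ⊕ τ'` (`2 + 2`).  In particular the Yoshida-type (decomposable) points `ρ_f ⊕ ρ_g` of the
ordinary family realise only the trivial class: they are not deformations of the non-split `ρ̄_B`, and an anchor /
propagation argument run on the realisation fibre of `[B] ≠ 0` never meets an endoscopic point.

**Proof** (over the NON-discrete valuation ring `ℤ̄_p`; no lattice theory, no hypothesis on `r` beyond the two
identities).  Suppose `Q⁻¹ r Q = τ ⊕ τ'`.  The idempotent `e = M E M⁻¹` (`M = P⁻¹Q`, `E = 1 ⊕ 0`) of `M₄(ℚ̄_p)`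
commutes with every `rint(g)`, `e² = e`, `tr e = 2`.
(A) `e` is INTEGRAL: otherwise rescale by an entry `q` of maximal norm `‖q‖ > 1`; `e₀ = q⁻¹ e` is integral with an
entry `1` and `e₀² = q⁻¹ e₀`, so its reduction `N ≠ 0` satisfies `N² = 0` and commutes with `ρ̄ = h (σ, B; 0, σ') h⁻¹`;
but the commutant of a NON-SPLIT `(σ, B; 0, σ')` is `k` (`commutant_nonsplit_eq_smul_one`: residual Schur — the
lower-left block intertwines `σ → σ'` hence vanishes, the diagonal blocks are scalars `a, d`, the upper-right block
gives `(a - d) B = σ X - X σ'`, so `a = d` as `B` is not a coboundary, and then `X` intertwines `σ' → σ`, hence `0`),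
so `N = a • 1` with `a² = 0`, i.e. `N = 0` — contradiction.
(B) So `ē = red(e)` is an idempotent of the commutant: `ē ∈ {0, 1}`, `tr ē ∈ {0, 4}`; but `tr ē = red(tr e) = 2`,
forcing `2 = 0` in `k`, i.e. `p = 2`.
Refs: Ribet 1976 Prop. 2.1 (converse direction); Bellaïche–Chenevier 2009 §1.5; Skinner–Wiles 1999 §2 (reducible
deformations of a non-split residual representation are non-split extensions).
-/

noncomputable section

open scoped MatrixGroups

open Matrix IsLocalRing

-- `Summit.Langlands.Langlands.…` (summit = sub-problem name, D-0017 layout) trips `dupNamespace` on every decl.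
set_option linter.dupNamespace false
set_option autoImplicit false

namespace Summit.Langlands.Langlands.Cruxes.ResiduallyYoshidaLifting.SectorKlingenSplit.Ribet

open Summit.Langlands.Langlands.Cruxes.ResiduallyYoshidaLifting.EndoscopicCrossingEuler
open Literature.NumberTheory.GaloisRepresentations

/-! ### No decomposable realiser of a non-trivial class -/

section Main

variable {p : ℕ} [Fact p.Prime]

/-- Entrywise: the reduction through `red` of a matrix commuting with the integral frame commutes with the
residual representation. [folklore] -/
theorem map_red_comm_of_comm {k : Type*} [CommRing k] {Γ : Type*}
    (red : Valued.integer (PadicAlgCl p) →+* k)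
    (rint : Γ → GL (Fin 4) (Valued.integer (PadicAlgCl p))) (Y : Matrix (Fin 4) (Fin 4) (Valued.integer (PadicAlgCl p)))
    (hY : ∀ g, ((rint g : GL (Fin 4) (Valued.integer (PadicAlgCl p))) :
        Matrix (Fin 4) (Fin 4) (Valued.integer (PadicAlgCl p))) * Y =
      Y * ((rint g : GL (Fin 4) (Valued.integer (PadicAlgCl p))) : Matrix (Fin 4) (Fin 4) (Valued.integer (PadicAlgCl p))))
    (g : Γ) :
    (Matrix.GeneralLinearGroup.map red (rint g)).val * Y.map red = Y.map red * (Matrix.GeneralLinearGroup.map red (rint g)).val := by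
  have h := congrArg (fun X : Matrix (Fin 4) (Fin 4) (Valued.integer (PadicAlgCl p)) => X.map red) (hY g)
  simp only [Matrix.map_mul] at h
  exact h

/-- From a commutation relation over `ℚ̄_p` between the integral frame and `q • Y₀.map subtype` back to a
commutation relation over `ℤ̄_p`. [folklore] -/
theorem comm_integral_of_comm_map {Γ : Type*}
    (rint : Γ → GL (Fin 4) (Valued.integer (PadicAlgCl p))) (Y₀ : Matrix (Fin 4) (Fin 4) (Valued.integer (PadicAlgCl p)))
    (Y : Matrix (Fin 4) (Fin 4) (PadicAlgCl p)) (q : PadicAlgCl p)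
    (hY₀ : Y₀.map (Valued.integer (PadicAlgCl p)).subtype = q • Y)
    (hcomm : ∀ g, ((rint g : GL (Fin 4) (Valued.integer (PadicAlgCl p))) :
        Matrix (Fin 4) (Fin 4) (Valued.integer (PadicAlgCl p))).map (Valued.integer (PadicAlgCl p)).subtype * Y =
      Y * ((rint g : GL (Fin 4) (Valued.integer (PadicAlgCl p))) :
        Matrix (Fin 4) (Fin 4) (Valued.integer (PadicAlgCl p))).map (Valued.integer (PadicAlgCl p)).subtype)
    (g : Γ) :
    ((rint g : GL (Fin 4) (Valued.integer (PadicAlgCl p))) : Matrix (Fin 4) (Fin 4) (Valued.integer (PadicAlgCl p))) * Y₀ =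
      Y₀ * ((rint g : GL (Fin 4) (Valued.integer (PadicAlgCl p))) : Matrix (Fin 4) (Fin 4) (Valued.integer (PadicAlgCl p))) := by
  apply Matrix.map_injective (f := ⇑(Valued.integer (PadicAlgCl p)).subtype) Subtype.val_injective
  change (((rint g : GL (Fin 4) (Valued.integer (PadicAlgCl p))) :
      Matrix (Fin 4) (Fin 4) (Valued.integer (PadicAlgCl p))) * Y₀).map (Valued.integer (PadicAlgCl p)).subtype =
    (Y₀ * ((rint g : GL (Fin 4) (Valued.integer (PadicAlgCl p))) :
      Matrix (Fin 4) (Fin 4) (Valued.integer (PadicAlgCl p)))).map (Valued.integer (PadicAlgCl p)).subtype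
  rw [Matrix.map_mul, Matrix.map_mul, hY₀, Matrix.mul_smul, Matrix.smul_mul, hcomm g]

/-- **No decomposable realiser of a non-trivial class** (core form; census F3(i) of crux `ResiduallyYoshidaLifting`).
Let `σ, σ' : Γ → GL₂(k)` be irreducible and non-conjugate over an algebraically closed field `k` of characteristic
`p ≠ 2`, and let `r : Γ → GL₄(ℚ̄_p)` have a `ℤ̄_p`-integral frame `rint = P⁻¹ r P` whose reduction through `red` is
`GL₄(k)`-conjugate to `(σ, B; 0, σ')` with `B` not a coboundary.  Then no `GL₄(ℚ̄_p)`-conjugate of `r` is block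
diagonal `τ ⊕ τ'`.  No hypothesis on `r` (not even that it is a homomorphism) is needed.
[cite: Ribet1976, Prop. 2.1] [cite: BellaicheChenevier2009, §1.5] -/
theorem not_blockDiagonal_of_realises_nonsplit {k : Type*} [Field k] [CharP k p] [IsAlgClosed k]
    {Γ : Type*} [Group Γ] (hp : p ≠ 2)
    (red : Valued.integer (PadicAlgCl p) →+* k) (σ σ' : Γ →* GL (Fin 2) k)
    (hσ : Representation.IsIrreducible ((glStdRepresentation (Fin 2) k).comp σ))
    (hσ' : Representation.IsIrreducible ((glStdRepresentation (Fin 2) k).comp σ'))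
    (hnc : ¬ ∃ u : GL (Fin 2) k, ∀ x, u * σ x * u⁻¹ = σ' x)
    (r : Γ → GL (Fin 4) (PadicAlgCl p)) (P : GL (Fin 4) (PadicAlgCl p))
    (rint : Γ → GL (Fin 4) (Valued.integer (PadicAlgCl p))) (h : GL (Fin 4) k)
    (B : Γ → Matrix (Fin 2) (Fin 2) k)
    (hP : ∀ g, Matrix.GeneralLinearGroup.map (Valued.integer (PadicAlgCl p)).subtype (rint g) = P⁻¹ * r g * P)
    (hred : ∀ g, (Matrix.GeneralLinearGroup.map red (rint g)).val =
      h.val * Matrix.reindex finSumFinEquiv finSumFinEquiv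
        (Matrix.fromBlocks (σ g).val (B g) 0 (σ' g).val) * (h⁻¹).val)
    (hB : ¬ ∃ X : Matrix (Fin 2) (Fin 2) k, ∀ g, B g = (σ g).val * X - X * (σ' g).val) :
    ¬ ∃ (Q : GL (Fin 4) (PadicAlgCl p)) (τ τ' : Γ → Matrix (Fin 2) (Fin 2) (PadicAlgCl p)),
      ∀ g, ((Q⁻¹ * r g * Q : GL (Fin 4) (PadicAlgCl p)) : Matrix (Fin 4) (Fin 4) (PadicAlgCl p)) =
        Matrix.reindex finSumFinEquiv finSumFinEquiv (Matrix.fromBlocks (τ g) 0 0 (τ' g)) := by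
  rintro ⟨Q, τ, τ', hQ⟩
  -- notation
  set sub := (Valued.integer (PadicAlgCl p)).subtype with hsubdef
  set E : Matrix (Fin 4) (Fin 4) (PadicAlgCl p) :=
    Matrix.reindex finSumFinEquiv finSumFinEquiv
      (Matrix.fromBlocks (1 : Matrix (Fin 2) (Fin 2) (PadicAlgCl p)) (0 : Matrix (Fin 2) (Fin 2) (PadicAlgCl p))
        (0 : Matrix (Fin 2) (Fin 2) (PadicAlgCl p)) (0 : Matrix (Fin 2) (Fin 2) (PadicAlgCl p))) with hEdef
  set M : GL (Fin 4) (PadicAlgCl p) := P⁻¹ * Q with hMdef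
  set e : Matrix (Fin 4) (Fin 4) (PadicAlgCl p) := M.val * E * (M⁻¹).val with hedef
  set D : Γ → Matrix (Fin 4) (Fin 4) (PadicAlgCl p) := fun g =>
    Matrix.reindex finSumFinEquiv finSumFinEquiv (Matrix.fromBlocks (τ g) 0 0 (τ' g)) with hDdef
  -- the block idempotent `E`
  have hEE : E * E = E := by
    rw [hEdef, ← reindex_mul_reindex, Matrix.fromBlocks_multiply]
    simp only [Matrix.mul_one, Matrix.mul_zero, add_zero]
  have hEtr : E.trace = 2 := by
    have htr : ∀ X : Matrix (Fin 2 ⊕ Fin 2) (Fin 2 ⊕ Fin 2) (PadicAlgCl p),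
        (Matrix.reindex (finSumFinEquiv : Fin 2 ⊕ Fin 2 ≃ Fin (2 + 2)) (finSumFinEquiv : Fin 2 ⊕ Fin 2 ≃ Fin (2 + 2)) X).trace =
          X.trace := fun X => by
      rw [Matrix.reindex_apply, Matrix.trace, Matrix.trace]
      exact Fintype.sum_equiv (finSumFinEquiv : Fin 2 ⊕ Fin 2 ≃ Fin (2 + 2)).symm _ _ (fun i => rfl)
    rw [hEdef, htr, Matrix.trace, Fintype.sum_sum_type]
    simp only [Matrix.diag_apply, Matrix.fromBlocks_apply₁₁, Matrix.fromBlocks_apply₂₂, Matrix.one_apply_eq,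
      Matrix.zero_apply, Finset.sum_const_zero, add_zero, Finset.sum_const, Finset.card_univ, Fintype.card_fin]
    norm_num
  have hED : ∀ g, D g * E = E * D g := by
    intro g
    rw [hDdef, hEdef, ← reindex_mul_reindex, ← reindex_mul_reindex, Matrix.fromBlocks_multiply,
      Matrix.fromBlocks_multiply]
    simp only [Matrix.mul_one, Matrix.mul_zero, Matrix.zero_mul, add_zero, Matrix.one_mul]
  -- the frame over `ℚ̄_p` is `M D M⁻¹`
  have hrK : ∀ g, ((rint g : GL (Fin 4) (Valued.integer (PadicAlgCl p))) :
      Matrix (Fin 4) (Fin 4) (Valued.integer (PadicAlgCl p))).map sub = M.val * D g * (M⁻¹).val := by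
    intro g
    have h1 : ((rint g : GL (Fin 4) (Valued.integer (PadicAlgCl p))) :
        Matrix (Fin 4) (Fin 4) (Valued.integer (PadicAlgCl p))).map sub =
        ((P⁻¹ * r g * P : GL (Fin 4) (PadicAlgCl p)) : Matrix (Fin 4) (Fin 4) (PadicAlgCl p)) := by
      rw [← hP g]
      rfl
    have h2 : (P⁻¹ * r g * P : GL (Fin 4) (PadicAlgCl p)) = M * (Q⁻¹ * r g * Q) * M⁻¹ := by
      rw [hMdef]
      group
    rw [h1, h2, Units.val_mul, Units.val_mul, hQ g]
  -- the idempotent `e`: `e² = e`, `tr e = 2`, commuting with the frame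
  have hee : e * e = e := by
    have : e * e = M.val * (E * ((M⁻¹).val * M.val) * E) * (M⁻¹).val := by
      simp only [hedef, Matrix.mul_assoc]
    rw [this, Units.inv_mul, Matrix.mul_one, hEE]
  have hetr : e.trace = 2 := by
    rw [hedef, Matrix.trace_units_conj, hEtr]
  have hcomm : ∀ g, ((rint g : GL (Fin 4) (Valued.integer (PadicAlgCl p))) :
      Matrix (Fin 4) (Fin 4) (Valued.integer (PadicAlgCl p))).map sub * e =
      e * ((rint g : GL (Fin 4) (Valued.integer (PadicAlgCl p))) :
        Matrix (Fin 4) (Fin 4) (Valued.integer (PadicAlgCl p))).map sub := by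
    intro g
    rw [hrK g, hedef]
    have e1 : M.val * D g * (M⁻¹).val * (M.val * E * (M⁻¹).val) = M.val * (D g * E) * (M⁻¹).val := by
      simp only [Matrix.mul_assoc, Units.inv_mul_cancel_left]
    have e2 : M.val * E * (M⁻¹).val * (M.val * D g * (M⁻¹).val) = M.val * (E * D g) * (M⁻¹).val := by
      simp only [Matrix.mul_assoc, Units.inv_mul_cancel_left]
    rw [e1, e2, hED g]
  -- the residual representation and its commutant
  have hscalar : ∀ N : Matrix (Fin 4) (Fin 4) k,
      (∀ g, (Matrix.GeneralLinearGroup.map red (rint g)).val * N = N * (Matrix.GeneralLinearGroup.map red (rint g)).val) →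
      ∃ a : k, N = a • (1 : Matrix (Fin 4) (Fin 4) k) := by
    intro N hN
    refine residualCommutant_eq_smul_one σ σ' hσ hσ' hnc B hB h N fun g => ?_
    rw [← hred g]
    exact hN g
  -- (A) `e` is integral
  have hint : ∀ i j, ‖e i j‖ ≤ 1 := by
    by_contra hne
    simp only [not_forall, not_le] at hne
    obtain ⟨i₁, j₁, hbig⟩ := hne
    obtain ⟨q, e₀, i₀, j₀, hq0, hq1, he₀, hone⟩ := exists_integral_rescale_of_one_lt e i₁ j₁ hbig
    have hqi1 : ‖q⁻¹‖ < 1 := by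
      rw [norm_inv]
      exact inv_lt_one_of_one_lt₀ hq1
    set qi : Valued.integer (PadicAlgCl p) := ⟨q⁻¹, (mem_integer_iff_norm_le_one _).2 hqi1.le⟩ with hqidef
    have hredqi : red qi = 0 := red_eq_zero_of_norm_lt_one red qi hqi1
    -- `e₀² = q⁻¹ e₀`
    have h1 : e₀ * e₀ = qi • e₀ := by
      apply Matrix.map_injective (f := ⇑sub) Subtype.val_injective
      change (e₀ * e₀).map sub = (qi • e₀).map sub
      have hs : (qi • e₀).map sub = q⁻¹ • e₀.map sub := by
        ext i j
        rfl
      rw [Matrix.map_mul, hs, he₀, Matrix.mul_smul, Matrix.smul_mul, hee, smul_smul]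
    -- `e₀` commutes with the integral frame
    have h2 := comm_integral_of_comm_map rint e₀ e q⁻¹ he₀ hcomm
    -- reduce
    have hN0 : e₀.map red ≠ 0 := by
      intro h0
      have h := congrFun (congrFun h0 i₀) j₀
      rw [Matrix.map_apply, hone, map_one] at h
      exact one_ne_zero h
    have hNN : e₀.map red * e₀.map red = 0 := by
      rw [← Matrix.map_mul, h1]
      ext i j
      simp only [Matrix.map_apply, Matrix.smul_apply, smul_eq_mul, map_mul, hredqi, zero_mul, Matrix.zero_apply]
    obtain ⟨a, ha⟩ := hscalar (e₀.map red) (map_red_comm_of_comm red rint e₀ h2)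
    have haa : a * a = 0 := by
      have h := congrFun (congrFun hNN 0) 0
      rw [ha, Matrix.smul_mul, Matrix.mul_smul, Matrix.mul_one, smul_smul, Matrix.smul_apply,
        Matrix.one_apply_eq, smul_eq_mul, mul_one, Matrix.zero_apply] at h
      exact h
    have ha0 : a = 0 := by
      rcases mul_eq_zero.mp haa with h | h <;> exact h
    apply hN0
    rw [ha, ha0, zero_smul]
  -- (B) the integral idempotent reduces to an idempotent of trace 2 in the commutant `k`
  set eO : Matrix (Fin 4) (Fin 4) (Valued.integer (PadicAlgCl p)) :=
    Matrix.of fun i j => ⟨e i j, (mem_integer_iff_norm_le_one _).2 (hint i j)⟩ with heOdef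
  have heO : eO.map sub = e := by
    ext i j
    rfl
  have h3 : eO * eO = eO := by
    apply Matrix.map_injective (f := ⇑sub) Subtype.val_injective
    change (eO * eO).map sub = eO.map sub
    rw [Matrix.map_mul, heO, hee]
  have h4 := comm_integral_of_comm_map rint eO e 1 (by rw [heO, one_smul]) hcomm
  obtain ⟨a, ha⟩ := hscalar (eO.map red) (map_red_comm_of_comm red rint eO h4)
  -- `a² = a`
  have haa : a * a = a := by
    have h := congrArg (fun X : Matrix (Fin 4) (Fin 4) (Valued.integer (PadicAlgCl p)) => X.map red) h3
    simp only [Matrix.map_mul] at h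
    have h' := congrFun (congrFun h 0) 0
    rw [ha, Matrix.smul_mul, Matrix.mul_smul, Matrix.mul_one, smul_smul] at h'
    simp only [Matrix.smul_apply, Matrix.one_apply_eq, smul_eq_mul, mul_one] at h'
    exact h'
  -- `tr ē = 4 a = red (tr e) = 2`
  have htrO : eO.trace = 2 := by
    apply Subtype.val_injective
    change sub eO.trace = sub 2
    rw [map_ofNat]
    have : sub eO.trace = (eO.map sub).trace := by
      simp only [Matrix.trace, Matrix.diag_apply, map_sum, Matrix.map_apply]
    rw [this, heO, hetr]
  have htrk : (eO.map red).trace = 2 := by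
    have : red eO.trace = (eO.map red).trace := by
      simp only [Matrix.trace, Matrix.diag_apply, map_sum, Matrix.map_apply]
    rw [← this, htrO, map_ofNat]
  have h2eq : (2 : k) = a * 4 := by
    rw [← htrk, ha, Matrix.trace_smul, Matrix.trace_one, Fintype.card_fin, smul_eq_mul]
    norm_num
  -- `a ∈ {0, 1}`, so `2 = 0` in `k`
  have h20 : (2 : k) = 0 := by
    have ha01 : a = 0 ∨ a = 1 := by
      have : a * (a - 1) = 0 := by rw [mul_sub, mul_one, haa, sub_self]
      rcases mul_eq_zero.mp this with h | h
      · exact Or.inl h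
      · exact Or.inr (sub_eq_zero.mp h)
    rcases ha01 with h | h
    · rw [h2eq, h, zero_mul]
    · have h24 : (2 : k) = 4 := by rw [h2eq, h, one_mul]
      have : (4 : k) - 2 = 2 := by norm_num
      rw [← this, ← h24, sub_self]
  -- hence `p ∣ 2`, i.e. `p = 2`
  have hp2 : p ∣ 2 := by
    have h := (CharP.cast_eq_zero_iff k p 2).mp (by exact_mod_cast h20)
    exact h
  exact hp ((Nat.prime_dvd_prime_iff_eq (Fact.out : p.Prime) Nat.prime_two).mp hp2)

end Main

/-! ### In the vocabulary of the registered stubs of line `sector-klingen-split` -/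

section Registered

/-- **No decomposable realiser** (registered sub-goal `stub_noDecomposableRealiser` of crux stmt-Langlands-13639, line
`sector-klingen-split`, skeleton rev 4; census F3(i)): if a framed Galois representation `r : Γ_ℚ → GL₄(ℚ̄_p)` REALISES a
residual cocycle `B` that is not a coboundary — an integral frame of `r` reduces through `red` to a `GL₄(k)`-conjugate of
`(σ, B; 0, σ')`, exactly the realisation clause of `stub_selmerAnchor` / `stub_nonsplitPropagation` — then no
`GL₄(ℚ̄_p)`-conjugate of `r` is block-diagonal `τ ⊕ τ'`: the realisation fibre of a non-trivial class contains no
Yoshida-type (decomposable) point. [cite: Ribet1976, Prop. 2.1] [cite: BellaicheChenevier2009, §1.5] -/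
theorem stub_noDecomposableRealiser :
    ∀ (p : ℕ) [Fact p.Prime], p ≠ 2 → ∀ (k : Type) [Field k] [CharP k p] [IsAlgClosed k]
      [TopologicalSpace k] [DiscreteTopology k] (red : Valued.integer (PadicAlgCl p) →+* k)
      (σ σ' : Literature.NumberTheory.GaloisRepresentations.FramedGaloisRep ℚ k 2)
      (r : Literature.NumberTheory.GaloisRepresentations.FramedGaloisRep ℚ (PadicAlgCl p) 4)
      (B : Field.absoluteGaloisGroup ℚ → Matrix (Fin 2) (Fin 2) k),
      σ.toGaloisRep.IsIrreducible → σ'.toGaloisRep.IsIrreducible →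
      (¬ ∃ g : GL (Fin 2) k, ∀ x, g * σ x * g⁻¹ = σ' x) →
      (¬ ∃ X : Matrix (Fin 2) (Fin 2) k, ∀ g, B g = (σ g).val * X - X * (σ' g).val) →
      (∃ (P : GL (Fin 4) (PadicAlgCl p))
        (rint : Field.absoluteGaloisGroup ℚ →* GL (Fin 4) (Valued.integer (PadicAlgCl p))) (h : GL (Fin 4) k),
        (∀ g, Matrix.GeneralLinearGroup.map (Valued.integer (PadicAlgCl p)).subtype (rint g) = P⁻¹ * r g * P) ∧
        (∀ g, (Matrix.GeneralLinearGroup.map red (rint g)).val =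
          h.val * Matrix.reindex finSumFinEquiv finSumFinEquiv
            (Matrix.fromBlocks (σ g).val (B g) 0 (σ' g).val) * (h⁻¹).val)) →
      ¬ ∃ (Q : GL (Fin 4) (PadicAlgCl p))
          (τ τ' : Field.absoluteGaloisGroup ℚ → Matrix (Fin 2) (Fin 2) (PadicAlgCl p)),
        ∀ g, ((Q⁻¹ * r g * Q : GL (Fin 4) (PadicAlgCl p)) : Matrix (Fin 4) (Fin 4) (PadicAlgCl p)) =
          Matrix.reindex finSumFinEquiv finSumFinEquiv (Matrix.fromBlocks (τ g) 0 0 (τ' g)) := by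
  intro p _ hp k _ _ _ _ _ red σ σ' r B hσ hσ' hnc hB hreal
  obtain ⟨P, rint, h, hP, hred⟩ := hreal
  have hσm : Representation.IsIrreducible ((glStdRepresentation (Fin 2) k).comp σ.toMonoidHom) := hσ
  have hσ'm : Representation.IsIrreducible ((glStdRepresentation (Fin 2) k).comp σ'.toMonoidHom) := hσ'
  exact not_blockDiagonal_of_realises_nonsplit hp red σ.toMonoidHom σ'.toMonoidHom hσm hσ'm hnc (fun g => r g) P
    (fun g => rint g) h B hP hred hB

end Registered

end Summit.Langlands.Langlands.Cruxes.ResiduallyYoshidaLifting.SectorKlingenSplit.Ribet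

end
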